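import Summits.HubbardSuperconductivity.HubbardSuperconductivity.Theses.PlaquetteBoson
import Summits.HubbardSuperconductivity.HubbardSuperconductivity.Theorems.TwTipContinuation.Negative.TipNormalForm
import Summits.HubbardSuperconductivity.HubbardSuperconductivity.Theorems.TwTipContinuation.Negative.AbstractTipShapeFalse
import Summits.HubbardSuperconductivity.HubbardSuperconductivity.Theorems.NoGoNogoThesis
import Literature.MathematicalPhysics.QuantumLattice.HubbardLiebTwoHoppingsSector
import Literature.Barriers.HubbardSuperconductivity.PureModelStripeCompetition

/-!
# `PbContinuation` (stmt-HubbardSuperconductivity-0907) — NORMAL FORM of the crux, what a refutation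
# needs, non-vacuity of the anchor matrix, and the abstract continuation shape is FALSE
# (negative-side support; refuter crux-attack 2026-08-17)

Route `PlaquetteBoson`, crux rank 5 ("the bet", continuation `t' → 1`), shared BY SIGNATURE with
`AnisotropyChord.Continuation`, `LevyLogBootstrap.Continuation`, `PolyaSchurPairBoson.Continuation`
(the four route decls are the same term, `Iff.rfl`). Definition-free bookkeeping on the LITERAL route
terms:

* `pbContinuation_iff_everyGSOrder` — **the crux in normal form**: for all `U > 0`, `δ ∈ (0,1/2)`,
  [every-GS `d_{x²-y²}` pair-field order `c(t') L⁴ ≤ re⟨ψ,(ΔᴴΔ)ψ⟩` of the checkerboard tori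
  `hamiltonian G_intra 1 U + hamiltonian G_inter t' 0` for all small `t'`, eventually in `L ∈ 4ℕ`]
  → [an eventual, uniform, every-GS bound `c L⁴ ≤ re⟨ψ,(ΔᴴΔ)ψ⟩` for the PURE torus
  `hubbardTorus 2 L 1 U` along ALL even `L`]. The summit-shaped conclusion (`HasLongRangeOrder` of
  every admissible ground-state sequence) is replaced by the every-GS bound through the landed
  `summitMatrix_iff_everyGSOrder` (`Theorems/TwTipContinuation/Negative/TipNormalForm.lean`).
* `not_pbContinuation_iff` — **what a refutation needs**: ONE `(U,δ)` with `U > 0`, `δ ∈ (0,1/2)` at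
  which the small-`t'` anchor holds AND some ground-state branch of the pure torus is dark
  (no uniform every-GS bound). Both conjuncts are thermodynamic-limit statements, open in 2026-08;
  expected physically in the corners `δ > 0.4`, `U ≤ 4` (`d_xy`/`p`, Deng et al. 2015) and the stripe
  window (Qin et al. 2020) IF the plaquette anchor reaches them.
* `anchor_of_not_pbContinuation`, `darkPure_of_not_pbContinuation` — the two halves separately, in
  contrapositive (negative-side) form: a refutation PROVES an instance of the small-`t'` plaquette
  anchor (VACUITY HAZARD: failure of the anchor at every `(U,δ)` proves the crux while killing every
  thesis `PbAnchorOrder ∧ PbContinuation`), and it REFUTES the summit's matrix at some `(U,δ)` (the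
  absurdly strong reading "pure-torus every-GS order everywhere" proves the crux without touching the
  anchor). Otherwise the crux is logically independent of the summit (`exact?`/`aesop` probes
  `PbContinuation → HubbardSuperconductivity` and conversely fail; with `PbAnchorOrder` it is
  `PlaquetteBoson.closes`).
* `not_anchor_of_pbContinuation_of_not_lroAt`, `not_anchor_eight_eighth_of_stripeCompetition` —
  **how the `∀ (U,δ)` form bites**: under the crux every absence-of-order statement for the PURE
  torus (`¬ HasDWavePairFieldLROAt U δ`, the barrier catalogue's negated matrix) becomes failure of
  the small-`t'` plaquette anchor at the same `(U,δ)`; instance: the registered open conjecture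
  `PureModelStripeCompetition` (Qin et al. 2020, `(U,δ) = (8,1/8)`) plus the crux forbid the anchor
  at `(8, 1/8)`. A corner `(U,δ)` with a PROVED anchor and a PROVED pure-model no-go is exactly what
  `not_pbContinuation_iff` asks for; none exists in 2026-08.
* `exists_unit_groundStateInSector_checkerboard` — **the anchor matrix is not vacuous**: at every
  side `L`, all hoppings `a, b`, every `U` and `δ ≥ -1` the checkerboard Hamiltonian has a normalised
  ground state in the sector `(2⌊(1-δ)L²/2⌋, S^z = 0)` (`LiebTwoHoppings.szSector_groundState₂`),
  so the anchor premise is a genuine every-GS order statement, never true for lack of states.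
* `not_abstractContinuationShape` — **the model-free shape of the crux is FALSE**: for the linear
  family `A + g•B` on `ℝ²` with `A = diag(0,1)`, `B = diag(0,-1)`, `P = diag(1,0) ≥ 0`, EVERY unit
  minimiser at EVERY coupling `g ∈ (0,1)` has `⟨P⟩ = 1` (lit, one constant for the whole path), yet
  at the endpoint `g = 1` the form is `0` and the dark vector `e₁` (`⟨P⟩ = 0`) is a ground state. So
  "every-GS order along the whole open path ⇒ every-GS order at the endpoint" fails by an exact
  degeneracy AT the endpoint (a fortiori a level crossing inside the path, the first-order d-CDW/PS
  scenario of Yao–Tsai–Kivelson 2007, also kills it): any proof of `PbContinuation` must use the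
  structure of the Hubbard family (cf. the sibling `not_abstractTipShape`,
  `not_abstractUniformRungsShape` for `TwTipContinuation`).

Folklore bookkeeping over the finite-dimensional variational principle (Tasaki 2020 §2.1–2.2; Kato
1966 II §6 for level crossing of analytic families); no new definitions.
-/

noncomputable section

namespace Summit.HubbardSuperconductivity.PbContinuation.Negative

open Matrix Filter
open Literature.MathematicalPhysics.QuantumLattice Literature.Probability.LatticeModels
open Summit.HubbardSuperconductivity.HubbardSuperconductivity.Theses.PlaquetteBoson (PbContinuation)
open Summit.HubbardSuperconductivity.TwTipContinuation.Negative (summitMatrix_iff_everyGSOrder toy_norm)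
open scoped ComplexOrder

/-! ### The crux in normal form -/

/-- **`PbContinuation` in normal form**: at every `U > 0`, `δ ∈ (0,1/2)`, the small-`t'` every-GS
anchor of the checkerboard tori (`L ∈ 4ℕ`) implies the eventual uniform every-GS `d`-wave pair-field
bound of the pure torus along all even sides (the summit's matrix at `(U,δ)` rewritten by
`summitMatrix_iff_everyGSOrder`, `δ > 0 ≥ -1`). [folklore] -/
theorem pbContinuation_iff_everyGSOrder :
    PbContinuation ↔
      ∀ (U δ : ℝ), 0 < U → δ ∈ Set.Ioo (0:ℝ) (1/2) →
        (∃ t₀ : ℝ, 0 < t₀ ∧ ∀ t' ∈ Set.Ioo (0:ℝ) t₀, ∃ c : ℝ, 0 < c ∧ ∃ L₀ : ℕ, ∀ (L : ℕ) [NeZero L],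
          L₀ ≤ L → 4 ∣ L → ∀ (N : ℕ) (ψ : Fock (Orb (FermionTorus 2 L))),
            N = 2 * ⌊(1 - δ) * (L : ℝ) ^ 2 / 2⌋₊ → star ψ ⬝ᵥ ψ = 1 →
            IsGroundStateInSector
              (hamiltonian ((fermionTorusGraph 2 L) \ SimpleGraph.comap
                  (fun x : FermionTorus 2 L => fun i : Fin 2 => ((ofLex x) i : ℕ) / 2) ⊤) 1 U +
                hamiltonian ((fermionTorusGraph 2 L) ⊓ SimpleGraph.comap
                  (fun x : FermionTorus 2 L => fun i : Fin 2 => ((ofLex x) i : ℕ) / 2) ⊤) t' 0) N 0 ψ →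
            c * (L : ℝ) ^ 4 ≤
              (expect ((pairField dWaveFormFactor L)ᴴ * pairField dWaveFormFactor L) ψ).re) →
        ∃ c : ℝ, 0 < c ∧ ∃ L₀ : ℕ, ∀ (L : ℕ) [NeZero L], L₀ ≤ L → Even L →
          ∀ ψ : Fock (Orb (FermionTorus 2 L)), star ψ ⬝ᵥ ψ = 1 →
            IsGroundStateInSector (hubbardTorus 2 L 1 U) (2 * ⌊(1 - δ) * (L : ℝ) ^ 2 / 2⌋₊) 0 ψ →
              c * (L : ℝ) ^ 4 ≤
                (expect ((pairField dWaveFormFactor L)ᴴ * pairField dWaveFormFactor L) ψ).re := by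
  unfold PbContinuation
  refine forall₂_congr fun U δ => forall_congr' fun _ => forall_congr' fun hδ =>
    forall_congr' fun _ => ?_
  have hδ' : (-1 : ℝ) ≤ δ := by linarith [hδ.1]
  exact summitMatrix_iff_everyGSOrder hδ'

/-- **What a refutation of `PbContinuation` needs**: one `(U,δ)`, `U > 0`, `δ ∈ (0,1/2)`, at which the
small-`t'` checkerboard anchor HOLDS and the pure torus has NO uniform every-GS `d`-wave pair-field
bound along even sides (a dark ground-state branch). [folklore] -/
theorem not_pbContinuation_iff :
    ¬ PbContinuation ↔
      ∃ (U δ : ℝ), 0 < U ∧ δ ∈ Set.Ioo (0:ℝ) (1/2) ∧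
        (∃ t₀ : ℝ, 0 < t₀ ∧ ∀ t' ∈ Set.Ioo (0:ℝ) t₀, ∃ c : ℝ, 0 < c ∧ ∃ L₀ : ℕ, ∀ (L : ℕ) [NeZero L],
          L₀ ≤ L → 4 ∣ L → ∀ (N : ℕ) (ψ : Fock (Orb (FermionTorus 2 L))),
            N = 2 * ⌊(1 - δ) * (L : ℝ) ^ 2 / 2⌋₊ → star ψ ⬝ᵥ ψ = 1 →
            IsGroundStateInSector
              (hamiltonian ((fermionTorusGraph 2 L) \ SimpleGraph.comap
                  (fun x : FermionTorus 2 L => fun i : Fin 2 => ((ofLex x) i : ℕ) / 2) ⊤) 1 U +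
                hamiltonian ((fermionTorusGraph 2 L) ⊓ SimpleGraph.comap
                  (fun x : FermionTorus 2 L => fun i : Fin 2 => ((ofLex x) i : ℕ) / 2) ⊤) t' 0) N 0 ψ →
            c * (L : ℝ) ^ 4 ≤
              (expect ((pairField dWaveFormFactor L)ᴴ * pairField dWaveFormFactor L) ψ).re) ∧
        ¬ (∃ c : ℝ, 0 < c ∧ ∃ L₀ : ℕ, ∀ (L : ℕ) [NeZero L], L₀ ≤ L → Even L →
          ∀ ψ : Fock (Orb (FermionTorus 2 L)), star ψ ⬝ᵥ ψ = 1 →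
            IsGroundStateInSector (hubbardTorus 2 L 1 U) (2 * ⌊(1 - δ) * (L : ℝ) ^ 2 / 2⌋₊) 0 ψ →
              c * (L : ℝ) ^ 4 ≤
                (expect ((pairField dWaveFormFactor L)ᴴ * pairField dWaveFormFactor L) ψ).re) := by
  rw [pbContinuation_iff_everyGSOrder]
  constructor
  · intro h
    by_contra hne
    apply h
    intro U δ hU hδ hA
    by_contra hD
    exact hne ⟨U, δ, hU, hδ, hA, hD⟩
  · rintro ⟨U, δ, hU, hδ, hA, hD⟩ h
    exact hD (h U δ hU hδ hA)

/-- **Any refutation of `PbContinuation` PROVES AN INSTANCE OF THE ANCHOR** (contrapositive of the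
vacuity hazard: if the small-`t'` every-GS anchor fails at every `U > 0`, `δ ∈ (0,1/2)`, the crux
holds vacuously while every thesis `PbAnchorOrder ∧ PbContinuation` dies through its first conjunct).
In particular `¬ PbContinuation` is at least as hard as the small-`t'` plaquette anchor at one point
of the open square `(0,∞) × (0,1/2)`. [folklore] -/
theorem anchor_of_not_pbContinuation (h : ¬ PbContinuation) :
    ∃ (U δ : ℝ), 0 < U ∧ δ ∈ Set.Ioo (0:ℝ) (1/2) ∧
      ∃ t₀ : ℝ, 0 < t₀ ∧ ∀ t' ∈ Set.Ioo (0:ℝ) t₀, ∃ c : ℝ, 0 < c ∧ ∃ L₀ : ℕ, ∀ (L : ℕ) [NeZero L],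
        L₀ ≤ L → 4 ∣ L → ∀ (N : ℕ) (ψ : Fock (Orb (FermionTorus 2 L))),
          N = 2 * ⌊(1 - δ) * (L : ℝ) ^ 2 / 2⌋₊ → star ψ ⬝ᵥ ψ = 1 →
          IsGroundStateInSector
            (hamiltonian ((fermionTorusGraph 2 L) \ SimpleGraph.comap
                (fun x : FermionTorus 2 L => fun i : Fin 2 => ((ofLex x) i : ℕ) / 2) ⊤) 1 U +
              hamiltonian ((fermionTorusGraph 2 L) ⊓ SimpleGraph.comap
                (fun x : FermionTorus 2 L => fun i : Fin 2 => ((ofLex x) i : ℕ) / 2) ⊤) t' 0) N 0 ψ →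
          c * (L : ℝ) ^ 4 ≤
            (expect ((pairField dWaveFormFactor L)ᴴ * pairField dWaveFormFactor L) ψ).re := by
  obtain ⟨U, δ, hU, hδ, hA, -⟩ := not_pbContinuation_iff.1 h
  exact ⟨U, δ, hU, hδ, hA⟩

/-- **Any refutation of `PbContinuation` REFUTES THE SUMMIT'S MATRIX AT SOME `(U,δ)`**: it exhibits a
`U > 0`, `δ ∈ (0,1/2)` at which the pure torus `hubbardTorus 2 L 1 U` has no uniform every-GS
`d`-wave pair-field bound along even sides (a dark ground-state branch; equivalently, by
`summitMatrix_iff_everyGSOrder`, an admissible ground-state sequence without `HasLongRangeOrder`).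
The (absurdly strong) reading "pure-torus every-GS order at every `(U,δ)`" therefore proves the crux
without touching the anchor. [folklore] -/
theorem darkPure_of_not_pbContinuation (h : ¬ PbContinuation) :
    ∃ (U δ : ℝ), 0 < U ∧ δ ∈ Set.Ioo (0:ℝ) (1/2) ∧
      ¬ (∃ c : ℝ, 0 < c ∧ ∃ L₀ : ℕ, ∀ (L : ℕ) [NeZero L], L₀ ≤ L → Even L →
        ∀ ψ : Fock (Orb (FermionTorus 2 L)), star ψ ⬝ᵥ ψ = 1 →
          IsGroundStateInSector (hubbardTorus 2 L 1 U) (2 * ⌊(1 - δ) * (L : ℝ) ^ 2 / 2⌋₊) 0 ψ →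
            c * (L : ℝ) ^ 4 ≤
              (expect ((pairField dWaveFormFactor L)ᴴ * pairField dWaveFormFactor L) ψ).re) := by
  obtain ⟨U, δ, hU, hδ, -, hD⟩ := not_pbContinuation_iff.1 h
  exact ⟨U, δ, hU, hδ, hD⟩

/-! ### How the `∀ (U,δ)` form bites: every pure-model no-go becomes a no-go for the plaquette anchor -/

/-- **Transfer of no-go statements.** Under `PbContinuation`, at every `U > 0`, `δ ∈ (0,1/2)` where
the summit's matrix FAILS for the pure torus (`¬ HasDWavePairFieldLROAt U δ`, the barrier
catalogue's name for the negated matrix — the conclusion of the crux at `(U,δ)` is that matrix word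
for word), the small-`t'` every-GS plaquette anchor fails too, for ALL `t₀ > 0`. This is the formal
shape of the recorded weakness "typed over ALL `(U,δ)`": the crux makes the checkerboard anchor
inherit, pointwise in `(U,δ)`, every absence-of-`d_{x²-y²}`-order statement about the PURE model
(`d_xy`/`p` corner `U ≤ 4`, `δ > 0.4`; stripes at `U ≈ 6–8`, `δ ≈ 1/8`). [folklore] -/
theorem not_anchor_of_pbContinuation_of_not_lroAt (hC : PbContinuation) {U δ : ℝ} (hU : 0 < U)
    (hδ : δ ∈ Set.Ioo (0:ℝ) (1/2))
    (hno : ¬ Literature.Barriers.HubbardSuperconductivity.HasDWavePairFieldLROAt U δ) :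
    ¬ (∃ t₀ : ℝ, 0 < t₀ ∧ ∀ t' ∈ Set.Ioo (0:ℝ) t₀, ∃ c : ℝ, 0 < c ∧ ∃ L₀ : ℕ, ∀ (L : ℕ) [NeZero L],
        L₀ ≤ L → 4 ∣ L → ∀ (N : ℕ) (ψ : Fock (Orb (FermionTorus 2 L))),
          N = 2 * ⌊(1 - δ) * (L : ℝ) ^ 2 / 2⌋₊ → star ψ ⬝ᵥ ψ = 1 →
          IsGroundStateInSector
            (hamiltonian ((fermionTorusGraph 2 L) \ SimpleGraph.comap
                (fun x : FermionTorus 2 L => fun i : Fin 2 => ((ofLex x) i : ℕ) / 2) ⊤) 1 U +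
              hamiltonian ((fermionTorusGraph 2 L) ⊓ SimpleGraph.comap
                (fun x : FermionTorus 2 L => fun i : Fin 2 => ((ofLex x) i : ℕ) / 2) ⊤) t' 0) N 0 ψ →
          c * (L : ℝ) ^ 4 ≤
            (expect ((pairField dWaveFormFactor L)ᴴ * pairField dWaveFormFactor L) ψ).re) :=
  fun hA => hno (hC U δ hU hδ hA)

/-- **The stripe barrier bites the crux at `(8, 1/8)`**: under the registered OPEN conjecture
`PureModelStripeCompetition` (no `d_{x²-y²}` pair-field LRO of the pure torus at `U = 8`,
`δ = 1/8`, transcribing Qin et al., PRX 10 (2020) 031016 §IV), `PbContinuation` forbids every-GS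
`d`-wave pair order of the checkerboard tori at `(8, 1/8)` for all small `t'` — the plaquette anchor
must fail there (physically expected anyway: `U = 8` lies outside the plaquette pair-binding window
`U < U_c ≈ 4.58`, Yao–Tsai–Kivelson 2007; recorded to show the mechanism by which a corner `(U,δ)`
WITH a valid anchor would refute the crux). [folklore] -/
theorem not_anchor_eight_eighth_of_stripeCompetition
    (hS : Literature.Barriers.HubbardSuperconductivity.PureModelStripeCompetition)
    (hC : PbContinuation) :
    ¬ (∃ t₀ : ℝ, 0 < t₀ ∧ ∀ t' ∈ Set.Ioo (0:ℝ) t₀, ∃ c : ℝ, 0 < c ∧ ∃ L₀ : ℕ, ∀ (L : ℕ) [NeZero L],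
        L₀ ≤ L → 4 ∣ L → ∀ (N : ℕ) (ψ : Fock (Orb (FermionTorus 2 L))),
          N = 2 * ⌊(1 - (1 / 8 : ℝ)) * (L : ℝ) ^ 2 / 2⌋₊ → star ψ ⬝ᵥ ψ = 1 →
          IsGroundStateInSector
            (hamiltonian ((fermionTorusGraph 2 L) \ SimpleGraph.comap
                (fun x : FermionTorus 2 L => fun i : Fin 2 => ((ofLex x) i : ℕ) / 2) ⊤) 1 8 +
              hamiltonian ((fermionTorusGraph 2 L) ⊓ SimpleGraph.comap
                (fun x : FermionTorus 2 L => fun i : Fin 2 => ((ofLex x) i : ℕ) / 2) ⊤) t' 0) N 0 ψ →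
          c * (L : ℝ) ^ 4 ≤
            (expect ((pairField dWaveFormFactor L)ᴴ * pairField dWaveFormFactor L) ψ).re) :=
  not_anchor_of_pbContinuation_of_not_lroAt hC (by norm_num) ⟨by norm_num, by norm_num⟩ hS

/-! ### The anchor matrix is not vacuous -/

/-- **Normalised sector ground states of the checkerboard tori exist** at every side `L`, for all
intra/inter-plaquette hoppings `a, b`, every `U` and every `δ ≥ -1`: the `(2⌊(1-δ)L²/2⌋, S^z = 0)`
sector of `hamiltonian G_intra a U + hamiltonian G_inter b 0` carries a unit ground state
(finite-dimensional spectral theory in the coordinate sector, `LiebTwoHoppings.szSector_groundState₂`;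
`⌊(1-δ)L²/2⌋ ≤ L² = |Λ_L|`). Hence the anchor premise of `PbContinuation` quantifies over a NONEMPTY
set of states at every `L`: it is a genuine every-GS order statement. [folklore] -/
theorem exists_unit_groundStateInSector_checkerboard (L : ℕ) (a b U δ : ℝ) (hδ : -1 ≤ δ) :
    ∃ ψ : Fock (Orb (FermionTorus 2 L)), star ψ ⬝ᵥ ψ = 1 ∧
      IsGroundStateInSector
        (hamiltonian ((fermionTorusGraph 2 L) \ SimpleGraph.comap
            (fun x : FermionTorus 2 L => fun i : Fin 2 => ((ofLex x) i : ℕ) / 2) ⊤) a U +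
          hamiltonian ((fermionTorusGraph 2 L) ⊓ SimpleGraph.comap
            (fun x : FermionTorus 2 L => fun i : Fin 2 => ((ofLex x) i : ℕ) / 2) ⊤) b 0)
        (2 * ⌊(1 - δ) * (L : ℝ) ^ 2 / 2⌋₊) 0 ψ := by
  have hn : ⌊(1 - δ) * (L : ℝ) ^ 2 / 2⌋₊ ≤ Fintype.card (FermionTorus 2 L) := by
    rw [Summit.HubbardSuperconductivity.NoGo.card_fermionTorus_two]
    exact Summit.HubbardSuperconductivity.NoGo.floor_pairNumber_le δ hδ L
  obtain ⟨⟨ψ, hψ⟩, -⟩ := LiebTwoHoppings.szSector_groundState₂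
    ((fermionTorusGraph 2 L) \ SimpleGraph.comap
        (fun x : FermionTorus 2 L => fun i : Fin 2 => ((ofLex x) i : ℕ) / 2) ⊤)
    ((fermionTorusGraph 2 L) ⊓ SimpleGraph.comap
        (fun x : FermionTorus 2 L => fun i : Fin 2 => ((ofLex x) i : ℕ) / 2) ⊤) a b U hn
  obtain ⟨c, hc, hc1⟩ := exists_smul_unit hψ.2.1
  exact ⟨c • ψ, hc1, Summit.HubbardSuperconductivity.NoGo.isGroundStateInSector_smul _ _ _ hψ hc⟩

/-- In particular the HYPOTHESES of the anchor matrix are jointly satisfiable at every side with the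
literal hoppings `(1, t')` of the crux: some `N`, `ψ` have `N = 2⌊(1-δ)L²/2⌋`, `‖ψ‖ = 1` and `ψ` a
sector ground state of the checkerboard Hamiltonian (`δ ∈ (0,1/2)`). [folklore] -/
theorem anchorHypotheses_satisfiable (L : ℕ) (U t' δ : ℝ) (hδ : δ ∈ Set.Ioo (0:ℝ) (1/2)) :
    ∃ (N : ℕ) (ψ : Fock (Orb (FermionTorus 2 L))),
      N = 2 * ⌊(1 - δ) * (L : ℝ) ^ 2 / 2⌋₊ ∧ star ψ ⬝ᵥ ψ = 1 ∧
        IsGroundStateInSector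
          (hamiltonian ((fermionTorusGraph 2 L) \ SimpleGraph.comap
              (fun x : FermionTorus 2 L => fun i : Fin 2 => ((ofLex x) i : ℕ) / 2) ⊤) 1 U +
            hamiltonian ((fermionTorusGraph 2 L) ⊓ SimpleGraph.comap
              (fun x : FermionTorus 2 L => fun i : Fin 2 => ((ofLex x) i : ℕ) / 2) ⊤) t' 0) N 0 ψ := by
  obtain ⟨ψ, h1, h2⟩ := exists_unit_groundStateInSector_checkerboard L 1 t' U δ (by linarith [hδ.1])
  exact ⟨_, ψ, rfl, h1, h2⟩

/-! ### The abstract continuation shape is false (exact degeneracy at the endpoint) -/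

/-- `⟨v, (A + gB) v⟩ = (1 − g) v₁²` for `A = diag(0,1)`, `B = diag(0,−1)`. [folklore] -/
theorem toyPath_form (g : ℝ) (v : Fin 2 → ℝ) :
    v ⬝ᵥ (Matrix.diagonal ![(0 : ℝ), 1] + g • Matrix.diagonal ![(0 : ℝ), -1]) *ᵥ v =
      (1 - g) * v 1 ^ 2 := by
  simp [Matrix.mulVec, dotProduct, Fin.sum_univ_two, Matrix.diagonal, Matrix.add_apply]
  ring

/-- `⟨v, P v⟩ = v₀²` for `P = diag(1,0)`. [folklore] -/
theorem toyPath_formP (v : Fin 2 → ℝ) : v ⬝ᵥ Matrix.diagonal ![(1 : ℝ), 0] *ᵥ v = v 0 ^ 2 := by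
  simp [Matrix.mulVec, dotProduct, Fin.sum_univ_two, Matrix.diagonal]
  ring

/-- **The abstract continuation shape is FALSE.** There are symmetric `A`, `B` and a positive
semidefinite `P` on `ℝ²` such that along the WHOLE open path `g ∈ (0,1)` every unit minimiser `v` of
`⟨v,(A + gB)v⟩` has `1 ≤ ⟨v,Pv⟩` (every-GS order with one constant), while at the endpoint `g = 1`
some unit minimiser has `⟨v,Pv⟩ = 0` (witness `A = diag(0,1)`, `B = diag(0,−1)`, `P = diag(1,0)`:
the endpoint form vanishes identically and the dark level `e₁` is a ground state). Hence no argument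
using only symmetry of the family, `P ≥ 0`, linearity in the coupling and every-GS order along the
open path can prove `PbContinuation`: the continuation `t' → 1` needs the structure of the Hubbard
family (no exact degeneracy / level crossing of the relevant sector ground states at the uniform
point). [folklore] -/
theorem not_abstractContinuationShape :
    ¬ (∀ (A B P : Matrix (Fin 2) (Fin 2) ℝ), P.PosSemidef →
        (∀ g : ℝ, 0 < g → g < 1 → ∀ v : Fin 2 → ℝ, (v ⬝ᵥ v = 1 ∧ ∀ w : Fin 2 → ℝ, w ⬝ᵥ w = 1 →
            v ⬝ᵥ (A + g • B) *ᵥ v ≤ w ⬝ᵥ (A + g • B) *ᵥ w) →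
          1 ≤ v ⬝ᵥ P *ᵥ v) →
        ∀ v : Fin 2 → ℝ, (v ⬝ᵥ v = 1 ∧ ∀ w : Fin 2 → ℝ, w ⬝ᵥ w = 1 →
            v ⬝ᵥ (A + (1 : ℝ) • B) *ᵥ v ≤ w ⬝ᵥ (A + (1 : ℝ) • B) *ᵥ w) →
          0 < v ⬝ᵥ P *ᵥ v) := by
  intro h
  have hP : (Matrix.diagonal ![(1 : ℝ), 0]).PosSemidef :=
    Matrix.PosSemidef.diagonal (by intro i; fin_cases i <;> simp)
  -- lit along the whole open path: the unique minimiser is `±e₀`, `⟨P⟩ = 1`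
  have hlit : ∀ g : ℝ, 0 < g → g < 1 → ∀ v : Fin 2 → ℝ, (v ⬝ᵥ v = 1 ∧ ∀ w : Fin 2 → ℝ, w ⬝ᵥ w = 1 →
      v ⬝ᵥ (Matrix.diagonal ![(0 : ℝ), 1] + g • Matrix.diagonal ![(0 : ℝ), -1]) *ᵥ v ≤
        w ⬝ᵥ (Matrix.diagonal ![(0 : ℝ), 1] + g • Matrix.diagonal ![(0 : ℝ), -1]) *ᵥ w) →
      1 ≤ v ⬝ᵥ Matrix.diagonal ![(1 : ℝ), 0] *ᵥ v := by
    rintro g - hg v ⟨hn, hmin⟩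
    have h1 := hmin ![1, 0] (by simp [dotProduct, Fin.sum_univ_two])
    rw [toyPath_form, toyPath_form] at h1
    rw [toy_norm] at hn
    rw [toyPath_formP]
    simp at h1
    nlinarith [sq_nonneg (v 1)]
  -- dark at the endpoint: the form is `0`, `e₁` is a ground state with `⟨P⟩ = 0`
  have hgs : (![0, 1] : Fin 2 → ℝ) ⬝ᵥ ![0, 1] = 1 ∧ ∀ w : Fin 2 → ℝ, w ⬝ᵥ w = 1 →
      ![0, 1] ⬝ᵥ (Matrix.diagonal ![(0 : ℝ), 1] + (1 : ℝ) • Matrix.diagonal ![(0 : ℝ), -1]) *ᵥ ![0, 1] ≤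
        w ⬝ᵥ (Matrix.diagonal ![(0 : ℝ), 1] + (1 : ℝ) • Matrix.diagonal ![(0 : ℝ), -1]) *ᵥ w := by
    refine ⟨by simp [dotProduct, Fin.sum_univ_two], fun w _ => ?_⟩
    rw [toyPath_form, toyPath_form]
    simp
  have := h _ _ _ hP hlit ![0, 1] hgs
  rw [toyPath_formP] at this
  simp at this

end Summit.HubbardSuperconductivity.PbContinuation.Negative

end
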